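import Summits.MatrixMultiplication.OmegaCensus.SmallFormats.InvertiblePointDeltaLaw
import Summits.MatrixMultiplication.OmegaCensus.SmallFormats.MatMul227GF3FootprintReduction
import HarnessLib

/-!
# ω-census family (a): `24 ≤ R_𝔽₃(⟨2,2,7⟩)` RE-PROVED by the δ-law (second kernel route to R441)

Cell `pub-omega` (unit `pub-omega-tensor`, gen 34), topic `Summits/MatrixMultiplication/OmegaCensus` (sub-folder
`SmallFormats`). Framing (verbatim): lottery ticket; floor = certified bounds/negative ranges. HONEST FRAMING: a second,
independent derivation of the tree theorem `twentyfour_le_tensorRank_227_gf3` (tensor g33, R441). Shared input: the kernel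
enumeration `Enum723.henum_227_gf3` (p623966: every X-marginal of a hypothetical 23-term `𝔽₃`-scheme for `⟨2,2,7⟩` is in the orbit
of `REP 0/1/2`) and the saturation of the points `satPoint j` for the transposed representatives (`card_vanishing_satPoint`,
`decide`, tensor g32). NEW route for the exclusion: instead of the footprint-catalog chain (1 068 / 2 255 pencil types, 6 765
Rado certificates, the `(9,7)` Weierstraß–Kronecker catalog), the δ-LAW `DeltaLaw.ten_mul_add_one_le_of_saturated` (this
generation, any field): a saturated invertible point forces `10·7 + 1 ≤ 3·23`, i.e. `71 ≤ 69` — absurd. Hence no 23-term scheme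
has X-marginal `REPT j`, hence (transpose move) none has `REP j` (`xMarginal_ne_REP_deltaLaw` = the hypothesis of
`twentyfour_le_tensorRank_227_gf3_of_exclusion`, which then yields R441's `24 ≤ R_𝔽₃(⟨2,2,7⟩) ≤ 25`; not restated here). A theorem about one small
tensor over one finite field; nothing on `ω`.
-/

namespace Summit.MatrixMultiplication.OmegaCensus.SmallFormats.Enum723

open Module Matrix Literature.Computability.AlgebraicComplexity RankOnePlaneCapGeneral

/-- The X-form of a computation with X-marginal `U` is `formOf (U i)`. -/
theorem f_eq_formOf_of_xMarginal_eq {k : Type*} [Field k] {n r : ℕ} (β : BilinComp (mulBilin k 2 2 n) (Fin r))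
    {U : Fin r → Matrix (Fin 2) (Fin 2) k} (h : xMarginal β = U) (i : Fin r) (X : Matrix (Fin 2) (Fin 2) k) :
    β.f i X = formOf (U i) X := by
  rw [f_apply_eq_sum_xMarginal, h, formOf_apply]

/-- **No 23-term `𝔽₃`-scheme for `⟨2,2,7⟩` has X-marginal `REPT j`** (`j < 3`): `satPoint j` would be a saturated invertible
point (exactly `14 = 2·7` forms nonzero), and the δ-law gives `71 ≤ 69`. -/
theorem xMarginal_ne_REPT_deltaLaw (j : ℕ) (hj : j < 3) (β : BilinComp (mulBilin (ZMod 3) 2 2 7) (Fin 23)) :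
    xMarginal β ≠ REPT j := by
  intro h
  have hvan := card_vanishing_satPoint j hj
  have hfilter : (Finset.univ.filter fun i => β.f i (satPoint j) ≠ 0) =
      Finset.univ.filter fun i => ¬ formOf (REPT j i) (satPoint j) = 0 := by
    refine Finset.filter_congr fun i _ => ?_
    rw [f_eq_formOf_of_xMarginal_eq β h]
  have hsplit := Finset.card_filter_add_card_filter_not
    (s := (Finset.univ : Finset (Fin 23))) (fun i => formOf (REPT j i) (satPoint j) = 0)
  rw [Finset.card_univ, Fintype.card_fin] at hsplit
  have hsat : (Finset.univ.filter fun i => β.f i (satPoint j) ≠ 0).card = 2 * 7 := by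
    rw [hfilter]; omega
  have hlaw := DeltaLaw.ten_mul_add_one_le_of_saturated (by norm_num) β (satPoint j) (isUnit_det_satPoint j) hsat
  rw [Fintype.card_fin] at hlaw
  omega

/-- **The exclusion hypothesis (hexcl) of the `(7,23)` census via the δ-law:** no 23-term `𝔽₃`-scheme for `⟨2,2,7⟩` has
X-marginal `REP j` (`j < 3`) — transpose move + `xMarginal_ne_REPT_deltaLaw`. With `henum_227_gf3` this is a second kernel route
to R441: `twentyfour_le_tensorRank_227_gf3_of_exclusion xMarginal_ne_REP_deltaLaw` re-proves
`twentyfour_le_tensorRank_227_gf3` (not restated here). -/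
theorem xMarginal_ne_REP_deltaLaw : ∀ j, j < 3 → ∀ β : BilinComp (mulBilin (ZMod 3) 2 2 7) (Fin 23),
    xMarginal β ≠ REP j := fun j hj =>
  forall_xMarginal_ne_of_transpose fun β => xMarginal_ne_REPT_deltaLaw j hj β

end Summit.MatrixMultiplication.OmegaCensus.SmallFormats.Enum723
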